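import Summits.HodgeConjecture.HodgeConjecture.Theorems.F0P3cCMBorelIwahoriDatumU2   -- ★ p849975 (this seat): `exists_cmIwahoriDatum₂_of_model` (the package BY SHAPE) + ★ p849951 part 1
import Summits.HodgeConjecture.HodgeConjecture.Theorems.F0P3cIwahoriDatumU2          -- ★ (U2-A) LH6-p05 (g2): `exists_iwahoriDatumU_two`, `dominant_package_two`, `nbar_torus_unipotent_inj`
import HarnessLib

/-!
# `F0P3cCMBorelIwahoriDatumU2Inst` — road (D) «DEEP-FL», block (U2-B) part 3 «THE INSTANCE»: the CM Iwahori datum package of the Borel of `H₂ = U(Φ₂)(L⁺_v)` at a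
# NON-SPLIT place ALONG A GIVEN RAY `a₂` (`E₂ a₂ = d(α, (σ_w α)⁻¹)`, `0 < |α|_w < 1`) — hypothesis-free: (U2-A)'s model datum ★ `exists_iwahoriDatumU_two` ∕
# ★ `dominant_package_two` ∕ ★ `nbar_torus_unipotent_inj` fed to ★ `exists_cmIwahoriDatum₂_of_model`

Cell `pub/hodgecm-mathlib`, crux H413 = `stmt-HodgeConjecture-24833` (lane `--supports … --as helper`), route HCCMUnconditional; seat LH4-p02 (g3) on the road (D)
owner LH6-p04 (g3)'s deal «IWAHORI-U2★» block (U2-B).  THEOREMS ONLY: no `def`, no instance, no notation, no `sorry`, no named fact.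
HONEST LABEL: HC_CM is proved only modulo the 7 printed citations (2 remaining: hLiu418 = stmt-HodgeConjecture-24832, h413 = stmt-HodgeConjecture-24833) until rung 0 closes;
count-neutral plumbing (the `𝓘₂ : (cmBorelTriple L 2 v).IwahoriDatum` + `haN ∕ haNbar ∕ hexh` BINDERS of ★ F1-H p849597 ∕ ★ `F0P3cStCharTSCassHTrace`, now DISCHARGED along any ray).

THE MATHEMATICS ([Casselman1995, Prop. 1.4.4]; [PlatonovRapinchuk1994, §5.1]; [Rogawski1990, §4.4 p. 46]).  For `a₂ ∈ H₂ = U(Φ₂)(L⁺_v)` whose one-place model `E₂ a₂` is the diagonal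
ray `d(α, (σ_w α)⁻¹)` with `0 < |α|_w < 1`: the model datum of (U2-A) (levels `K′_j = K_{|α|^{j+1}} ∩ U′`, `N̄′ = w₀ N′ w₀`, ray `E₂ a₂`) is dominant at its ray because
`|α| < 1 < |α|⁻¹ = |(σ_w α)⁻¹|` (★ `dominant_package_two`), its levels are integral (★ `congruenceGL_le_glInt`), and `N̄′·T′·N′` has unique `N′`-components (★
`nbar_torus_unipotent_inj`); ★ `exists_cmIwahoriDatum₂_of_model` transports everything to `cmBorelTriple L 2 v`.

* **`exists_cmIwahoriDatum₂`** — `∃ (𝓘 : (cmBorelTriple L 2 v).IwahoriDatum) (K₀ : Subgroup H₂), 𝓘.a = a₂ ∧ IsCompact K₀ ∧ IsOpen K₀ ∧ Z(H₂) ≤ K₀ ∧ (∀ n, 𝓘.K n ≤ K₀) ∧ hKK₀ ∧ haN ∧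
  haNbar ∧ hexh ∧ hinj ∧ (K₀ ↔ GL₂(𝒪_w)) ∧ (∀ n, 𝓘.K n = (K_{|α|^{n+1}} ∩ U′).comap E₂) ∧ 𝓘.Nbar = (w₀ N′ w₀).comap E₂` — the `N = 2` twin of ★
  `F0P3CMBorelIwahoriDatum.exists_cmIwahoriDatum` (clauses 1–10, 12; the shell-disjointness clause 11 awaits an `N = 2` `EntryHeight` and is not needed on road (D)).

## References
* [Casselman1995] W. Casselman, *Introduction to the theory of admissible representations of `p`-adic reductive groups* (draft 1 May 1995), Prop. 1.4.3, Prop. 1.4.4 p. 14.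
* [Rogawski1990] J. D. Rogawski, *Automorphic Representations of Unitary Groups in Three Variables* (1990), §1.10 p. 9; §4.4 p. 46.
* [PlatonovRapinchuk1994] V. Platonov, A. Rapinchuk, *Algebraic Groups and Number Theory* (1994), §2.3, §5.1.
-/

set_option autoImplicit false
-- the mandated namespace has the single-problem summit's repeated segment (`HodgeConjecture.HodgeConjecture`)
set_option linter.dupNamespace false

open scoped MatrixGroups Pointwise WithZero
open ValuativeRel Matrix
open Literature.NumberTheory Literature.NumberTheory.Automorphic Literature.NumberTheory.Automorphic.UnitaryGroup
open _root_.NumberField _root_.IsDedekindDomain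
open Summit.HodgeConjecture.HodgeConjecture.Cruxes.H413.F0P3cCMLocalNonsplitBorelTransportU2

namespace Summit.HodgeConjecture.HodgeConjecture.Cruxes.H413.F0P3cCMBorelIwahoriDatumU2

variable (L : Type) [Field L] [NumberField L] [IsCMField L] (v : HeightOneSpectrum (𝓞 ↥(maximalRealSubfield L)))
  (w : PlacesOver L v) (hw : IsCMField.complexConj L • w.1 = w.1)

set_option maxHeartbeats 1600000 in  -- the one-place model vs the CM carrier: long defeq unfoldings of `cmLocalForm` in the 13 transported clauses (as ★ (T1) for `N = 3`)
/-- **THE CM IWAHORI DATUM PACKAGE FOR `U(Φ₂)(L⁺_v)` ALONG A RAY (T1₂, hypothesis-free).**  At a non-split `v` (`w ∣ v`, `c • w = w`), for `a₂ ∈ H₂ = U(Φ₂)(L⁺_v)` whose image in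
the one-place model is the diagonal ray `d(α, (σ_w α)⁻¹)` with `0 < |α|_w < 1`: there are an Iwahori datum `𝓘` for ★ `cmBorelTriple L 2 v` WITH RAY `𝓘.a = a₂` and a compact open
`K₀ = U(Φ₂)(𝒪_v)` containing the centre and every level, with `hKK₀` (levels normalised by `K₀`), `haN`, `haNbar`, `hexh` (the BINDER texts of ★ `F0P3cStCharTSCassHTrace` :114–116 ∕
★ F1-H p849597), `hinj` (unique `N`-components in `N̄·T·N`), the description `k ∈ K₀ ↔ E₂ k ∈ GL₂(𝒪_w)`, and the bookkeeping `𝓘.K n = (K_{|α|^{n+1}} ∩ U′).comap E₂`,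
`𝓘.Nbar = (w₀N′w₀).comap E₂` (for dominance at other torus points, (U2-C)).  Proof: (U2-A) ★ `exists_iwahoriDatumU_two` + ★ `dominant_package_two` (at `e = (α, (σ_w α)⁻¹)`,
`|α| < |σ_w α|⁻¹`) + ★ `nbar_torus_unipotent_inj`, fed to ★ `exists_cmIwahoriDatum₂_of_model`. [cite: Casselman1995, Prop. 1.4.4 p. 14] [cite: PlatonovRapinchuk1994, §5.1]
[cite: Rogawski1990, §1.10 p. 9; §4.4 p. 46] -/
theorem exists_cmIwahoriDatum₂ (a : ↥(unitaryGroupOfForm (conjLocal L (IsCMField.complexConj L) v) (cmLocalForm L 2 v)))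
    {α : w.1.adicCompletion L} (hα0 : α ≠ 0) (hα1 : Valued.v α < 1)
    (ha : ((((localNonsplitEquiv (IsCMField.complexConj L) (Matrix.of fun i j : Fin 2 => if i.val + j.val + 1 = 2 then (1 : L) else 0)
        (IsCMField.complexConj_ne_one L) w hw) a :
          ↥(unitaryGroupOfForm (galAdicCompletionMap (L := L) (IsCMField.complexConj L) hw)
            (placeForm (Matrix.of fun i j : Fin 2 => if i.val + j.val + 1 = 2 then (1 : L) else 0) w.1))) :
          GL (Fin 2) (w.1.adicCompletion L)) : Matrix (Fin 2) (Fin 2) (w.1.adicCompletion L)) =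
      Matrix.diagonal ![α, ((galAdicCompletionMap (L := L) (IsCMField.complexConj L) hw) α)⁻¹]) :
    ∃ (𝓘 : (cmBorelTriple L 2 v).IwahoriDatum) (K₀ : Subgroup ↥(unitaryGroupOfForm (conjLocal L (IsCMField.complexConj L) v) (cmLocalForm L 2 v))),
      𝓘.a = a ∧ IsCompact (K₀ : Set ↥(unitaryGroupOfForm (conjLocal L (IsCMField.complexConj L) v) (cmLocalForm L 2 v))) ∧
      IsOpen (K₀ : Set ↥(unitaryGroupOfForm (conjLocal L (IsCMField.complexConj L) v) (cmLocalForm L 2 v))) ∧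
      Subgroup.center ↥(unitaryGroupOfForm (conjLocal L (IsCMField.complexConj L) v) (cmLocalForm L 2 v)) ≤ K₀ ∧ (∀ n, 𝓘.K n ≤ K₀) ∧
      (∀ n, ∀ k ∈ K₀, ∀ κ ∈ 𝓘.K n, k⁻¹ * κ * k ∈ 𝓘.K n) ∧
      (∀ n, ∀ x ∈ 𝓘.K n ⊓ (cmBorelTriple L 2 v).N, 𝓘.a * x * 𝓘.a⁻¹ ∈ 𝓘.K n) ∧
      (∀ n, ∀ x ∈ 𝓘.K n ⊓ 𝓘.Nbar, 𝓘.a⁻¹ * x * 𝓘.a ∈ 𝓘.K n ⊓ 𝓘.Nbar) ∧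
      (∀ n, ∀ x ∈ (cmBorelTriple L 2 v).N, ∃ m : ℕ, ∀ m', m ≤ m' → 𝓘.a ^ m' * x * (𝓘.a ^ m')⁻¹ ∈ 𝓘.K n) ∧
      (∀ nb ∈ 𝓘.Nbar, ∀ m ∈ (cmBorelTriple L 2 v).M, ∀ n ∈ (cmBorelTriple L 2 v).N, ∀ nb' ∈ 𝓘.Nbar, ∀ m' ∈ (cmBorelTriple L 2 v).M,
          ∀ n' ∈ (cmBorelTriple L 2 v).N, nb * m * n = nb' * m' * n' → n = n') ∧
      (∀ k : ↥(unitaryGroupOfForm (conjLocal L (IsCMField.complexConj L) v) (cmLocalForm L 2 v)), k ∈ K₀ ↔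
        (((localNonsplitEquiv (IsCMField.complexConj L) (Matrix.of fun i j : Fin 2 => if i.val + j.val + 1 = 2 then (1 : L) else 0)
            (IsCMField.complexConj_ne_one L) w hw) k :
          ↥(unitaryGroupOfForm (galAdicCompletionMap (L := L) (IsCMField.complexConj L) hw)
            (placeForm (Matrix.of fun i j : Fin 2 => if i.val + j.val + 1 = 2 then (1 : L) else 0) w.1))) :
            GL (Fin 2) (w.1.adicCompletion L)) ∈ glInt 2 (w.1.adicCompletion L)) ∧
      (∀ n, 𝓘.K n = ((congruenceGL 2 (valuation (w.1.adicCompletion L) α ^ (n + 1))).comap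
          (unitaryGroupOfForm (galAdicCompletionMap (L := L) (IsCMField.complexConj L) hw)
            (placeForm (Matrix.of fun i j : Fin 2 => if i.val + j.val + 1 = 2 then (1 : L) else 0) w.1)).subtype).comap
        (localNonsplitEquiv (IsCMField.complexConj L) (Matrix.of fun i j : Fin 2 => if i.val + j.val + 1 = 2 then (1 : L) else 0)
            (IsCMField.complexConj_ne_one L) w hw :
          «local» L (IsCMField.complexConj L) 2 (Matrix.of fun i j : Fin 2 => if i.val + j.val + 1 = 2 then (1 : L) else 0) v →*
            ↥(unitaryGroupOfForm (galAdicCompletionMap (L := L) (IsCMField.complexConj L) hw)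
              (placeForm (Matrix.of fun i j : Fin 2 => if i.val + j.val + 1 = 2 then (1 : L) else 0) w.1)))) ∧
      𝓘.Nbar = (((borelTriple (galAdicCompletionMap (L := L) (IsCMField.complexConj L) hw)
          (placeForm (Matrix.of fun i j : Fin 2 => if i.val + j.val + 1 = 2 then (1 : L) else 0) w.1) (placeForm_antidiagTwo_eq L v w)).N).map
          (MulAut.conj (weylLongU (galAdicCompletionMap (L := L) (IsCMField.complexConj L) hw) (placeForm_antidiagTwo_eq L v w))).toMonoidHom).comap
        (localNonsplitEquiv (IsCMField.complexConj L) (Matrix.of fun i j : Fin 2 => if i.val + j.val + 1 = 2 then (1 : L) else 0)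
            (IsCMField.complexConj_ne_one L) w hw :
          «local» L (IsCMField.complexConj L) 2 (Matrix.of fun i j : Fin 2 => if i.val + j.val + 1 = 2 then (1 : L) else 0) v →*
            ↥(unitaryGroupOfForm (galAdicCompletionMap (L := L) (IsCMField.complexConj L) hw)
              (placeForm (Matrix.of fun i j : Fin 2 => if i.val + j.val + 1 = 2 then (1 : L) else 0) w.1))) := by
  have hJw := placeForm_antidiagTwo_eq L v w
  have hσc : Continuous (galAdicCompletionMap (L := L) (IsCMField.complexConj L) hw) := continuous_galAdicCompletionMap (L := L) (IsCMField.complexConj L) hw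
  have hσv : ∀ x, Valued.v ((galAdicCompletionMap (L := L) (IsCMField.complexConj L) hw) x) = Valued.v x :=
    fun x => valued_galAdicCompletionMap (L := L) (IsCMField.complexConj L) hw x
  have hσv' : ∀ x, valuation (w.1.adicCompletion L) ((galAdicCompletionMap (L := L) (IsCMField.complexConj L) hw) x) = valuation (w.1.adicCompletion L) x :=
    fun x => (v_eq_iff_valuation_eq _ _).1 (hσv x)
  have hα1' : valuation (w.1.adicCompletion L) α < 1 := (v_lt_one_iff_valuation_lt_one α).1 hα1
  have hq0 : valuation (w.1.adicCompletion L) α ≠ 0 := (Valuation.ne_zero_iff _).2 hα0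
  have hlt : valuation (w.1.adicCompletion L) α < valuation (w.1.adicCompletion L) ((galAdicCompletionMap (L := L) (IsCMField.complexConj L) hw) α)⁻¹ := by
    rw [map_inv₀, hσv']
    exact hα1'.trans ((one_lt_inv₀ (zero_lt_iff.2 hq0)).2 hα1')
  -- (U2-A): the model datum along `E₂ a` and its dominance package
  obtain ⟨𝓘', ha', hNbar', hK'⟩ := F0P3cIwahoriDatumU2.exists_iwahoriDatumU_two (galAdicCompletionMap (L := L) (IsCMField.complexConj L) hw) hJw hσc hσv' hα0 hα1' _ ha
  have hdom := fun j => F0P3cIwahoriDatumU2.dominant_package_two (galAdicCompletionMap (L := L) (IsCMField.complexConj L) hw) hJw hq0 hα1' _ ha hlt j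
  have hK'le : ∀ n, 𝓘'.K n ≤ (glInt 2 (w.1.adicCompletion L)).comap
      (unitaryGroupOfForm (galAdicCompletionMap (L := L) (IsCMField.complexConj L) hw)
        (placeForm (Matrix.of fun i j : Fin 2 => if i.val + j.val + 1 = 2 then (1 : L) else 0) w.1)).subtype := by
    intro n x hx
    rw [hK' n] at hx
    exact congruenceGL_le_glInt _ hx
  have haN' : ∀ n, ∀ x ∈ 𝓘'.K n ⊓ (borelTriple (galAdicCompletionMap (L := L) (IsCMField.complexConj L) hw)
      (placeForm (Matrix.of fun i j : Fin 2 => if i.val + j.val + 1 = 2 then (1 : L) else 0) w.1) (placeForm_antidiagTwo_eq L v w)).N,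
      𝓘'.a * x * 𝓘'.a⁻¹ ∈ 𝓘'.K n := by
    intro n; rw [hK' n, ha']; exact (hdom n).1
  have haNbar' : ∀ n, ∀ x ∈ 𝓘'.K n ⊓ 𝓘'.Nbar, 𝓘'.a⁻¹ * x * 𝓘'.a ∈ 𝓘'.K n ⊓ 𝓘'.Nbar := by
    intro n; rw [hK' n, ha', hNbar']; exact (hdom n).2.1
  have hexh' : ∀ n, ∀ x ∈ (borelTriple (galAdicCompletionMap (L := L) (IsCMField.complexConj L) hw)
      (placeForm (Matrix.of fun i j : Fin 2 => if i.val + j.val + 1 = 2 then (1 : L) else 0) w.1) (placeForm_antidiagTwo_eq L v w)).N,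
      ∃ m : ℕ, ∀ m', m ≤ m' → 𝓘'.a ^ m' * x * (𝓘'.a ^ m')⁻¹ ∈ 𝓘'.K n := by
    intro n; rw [hK' n, ha']; exact (hdom n).2.2.1
  have hnorm' : ∀ n, ∀ k ∈ (glInt 2 (w.1.adicCompletion L)).comap
      (unitaryGroupOfForm (galAdicCompletionMap (L := L) (IsCMField.complexConj L) hw)
        (placeForm (Matrix.of fun i j : Fin 2 => if i.val + j.val + 1 = 2 then (1 : L) else 0) w.1)).subtype, ∀ κ ∈ 𝓘'.K n, k⁻¹ * κ * k ∈ 𝓘'.K n := by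
    intro n; rw [hK' n]; exact (hdom n).2.2.2
  have hinj' : ∀ nb ∈ 𝓘'.Nbar, ∀ m ∈ (borelTriple (galAdicCompletionMap (L := L) (IsCMField.complexConj L) hw)
          (placeForm (Matrix.of fun i j : Fin 2 => if i.val + j.val + 1 = 2 then (1 : L) else 0) w.1) (placeForm_antidiagTwo_eq L v w)).M,
        ∀ n ∈ (borelTriple (galAdicCompletionMap (L := L) (IsCMField.complexConj L) hw)
          (placeForm (Matrix.of fun i j : Fin 2 => if i.val + j.val + 1 = 2 then (1 : L) else 0) w.1) (placeForm_antidiagTwo_eq L v w)).N,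
        ∀ nb' ∈ 𝓘'.Nbar, ∀ m' ∈ (borelTriple (galAdicCompletionMap (L := L) (IsCMField.complexConj L) hw)
          (placeForm (Matrix.of fun i j : Fin 2 => if i.val + j.val + 1 = 2 then (1 : L) else 0) w.1) (placeForm_antidiagTwo_eq L v w)).M,
        ∀ n' ∈ (borelTriple (galAdicCompletionMap (L := L) (IsCMField.complexConj L) hw)
          (placeForm (Matrix.of fun i j : Fin 2 => if i.val + j.val + 1 = 2 then (1 : L) else 0) w.1) (placeForm_antidiagTwo_eq L v w)).N,
        nb * m * n = nb' * m' * n' → n = n' := by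
    rw [hNbar']
    exact F0P3cIwahoriDatumU2.nbar_torus_unipotent_inj (galAdicCompletionMap (L := L) (IsCMField.complexConj L) hw) hJw
  obtain ⟨𝓘, K₀, h1, h2, h3, h4, h5, h6, h7, h8, h9, h10, -, h12, h13, h14⟩ :=
    exists_cmIwahoriDatum₂_of_model L v w hw a 𝓘' ha' hK'le haN' haNbar' hexh' hnorm'
  refine ⟨𝓘, K₀, h1, h2, h3, h4, h5, h6, h7, h8, h9, h10 hinj', h12, fun n => ?_, ?_⟩
  · rw [h13 n, hK' n]
  · rw [h14, hNbar']

end Summit.HodgeConjecture.HodgeConjecture.Cruxes.H413.F0P3cCMBorelIwahoriDatumU2
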